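import Summits.CriticalPhenomena.PercolationContinuityZ3.Theorems.PercNearOneGluingNoHeavyLowerTailMajorityGluingSix
import Summits.CriticalPhenomena.PercolationContinuityZ3.Theorems.PercNearOneGluingNoHeavyLowerTailMajorityGluingEightAbstract
import HarnessLib

/-!
# Four of six relays cut from the hub: `μ ≤ (4/3)·max_i μ(vᵢ ↮ a₀)` from van den Berg–Kahn log-supermodularity (lane prim-rate, constants-miner 1, gen 32; CANDIDATES §GEN-32 R317)

Support file for the closed crux `NoHeavyLowerTail` (stmt-CriticalPhenomena-4575), majority-gluing line; percolation assembly on the abstract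
core `…MajorityGluingEightAbstract` (the `(6,4)` analogue of `…MajorityGluingSix` / `…MajorityGluingSeven`).  For a hub `a₀`, six relays `T`
and `δ ≥ max_{v∈T} μ(v ↮ a₀)`:  **`μ(at least four relays of T cut from a₀) ≤ (4/3)·δ`** (`fourOfSix_count`) — the constant of the ROOT
CELL `R_4 = (6,4)` obtainable from van den Berg–Kahn rooted at the hub (it is the sup of the abstract programme, kit j258594; Markov gives
`3/2`).  Steps:
* PARTITION by the cut set `C ⊆ T` (`real_eq_sum_cutAtoms`; atoms `{ω : cut set = C}`): the avoidance probability of `U ⊆ T` is the mass of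
  the atoms `C ⊇ U` (`avoid_real_eq_sum`), so `Σ_{|U| = j} μ(U cut) = Σ_C C(|C|, j)·μ(atom C)` (`sum_avoid_powersetCard`), and the
  pointwise majorant `1[|C| ≥ 4] ≤ (4/15)C(|C|,2) − (3/20)C(|C|,3)` gives the LAW-LEVEL inequality
  `μ(N ≥ 4) ≤ (4/15)·Σ_{pairs} μ(pair cut) − (3/20)·Σ_{triples} μ(triple cut)` (`fourOfSix_lin`; any law);
* van den Berg–Kahn per triple (`per_triple_avoid`): the three pairs `p, q` of a triple `t` satisfy `μ(p cut)μ(q cut) ≤ μ((p∩q) cut)μ(t cut)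
  ≤ δ·μ(t cut)` (`avoid_real_bk`, [VandenbergKahn2001, Thm 1.2]), so `three_pairs_le` bounds the triple's bracket by `δ/15`; regrouping the
  `15` pairs into the `20` triples (`sum_pairs_by_triples`) gives `(4/15)Σ₂ − (3/20)Σ₃ ≤ 20·δ/15 = (4/3)δ` (`fourOfSix_vdBK`).
The majority-gluing consequences (`C(8), C(9) ≤ 7/3`; `= 2` for `max ≥ 1/4`) are drawn in `…MajorityGluingEightHarris`.
No definitions, no sorries. [cite: VandenbergKahn2001, Thm 1.2 (p. 123)]
-/

noncomputable section

namespace Summit.CriticalPhenomena.PercolationContinuityZ3.Theorems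

open MeasureTheory Set
open Literature.Probability.LatticeModels (prodBernoulli)
open Literature.Probability.Percolation
open scoped Classical

namespace HubOnly

variable {n : ℕ}

/-! ### Partition by the cut set of `T` -/

/-- **Partition by the cut set.** For every event `S` and relay set `T`: `μ(S) = Σ_{C ⊆ T} μ(S ∩ {cut set of T = C})`. [folklore] -/
theorem real_eq_sum_cutAtoms (w : Sym2 (Fin n) → unitInterval) (a₀ : Fin n) (T : Finset (Fin n))
    (S : Set (BondConfig (Fin n))) :
    (prodBernoulli w).real S = ∑ C ∈ T.powerset, (prodBernoulli w).real
      (S ∩ {ω | T.filter (fun x => ω ∉ (openConn a₀ x : Set (BondConfig (Fin n)))) = C}) := by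
  have hms : ∀ S' : Set (BondConfig (Fin n)), MeasurableSet S' := fun _ => MeasurableSet.of_discrete
  have h := sum_measureReal_preimage_singleton (μ := (prodBernoulli w).restrict S) T.powerset
    (f := fun ω : BondConfig (Fin n) => T.filter (fun x => ω ∉ (openConn a₀ x : Set (BondConfig (Fin n)))))
    (fun C _ => hms _)
  have hpre : (fun ω : BondConfig (Fin n) => T.filter (fun x => ω ∉ (openConn a₀ x : Set (BondConfig (Fin n))))) ⁻¹'
      (↑T.powerset : Set (Finset (Fin n))) = univ := by
    refine eq_univ_of_forall fun ω => ?_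
    rw [mem_preimage, Finset.mem_coe, Finset.mem_powerset]
    exact Finset.filter_subset _ _
  rw [hpre, measureReal_restrict_apply_univ] at h
  rw [← h]
  refine Finset.sum_congr rfl fun C _ => ?_
  rw [measureReal_restrict_apply (hms _), inter_comm]
  rfl

/-- On the atom `{cut set = C}` the avoidance event of `U ⊆ T` is everything if `U ⊆ C` and nothing otherwise. [folklore] -/
theorem avoid_inter_cutAtom (a₀ : Fin n) (T U C : Finset (Fin n)) (hU : U ⊆ T) :
    {ω : BondConfig (Fin n) | ∀ x ∈ (U : Set (Fin n)), ω ∉ (openConn a₀ x : Set (BondConfig (Fin n)))} ∩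
      {ω | T.filter (fun x => ω ∉ (openConn a₀ x : Set (BondConfig (Fin n)))) = C} =
    if U ⊆ C then {ω | T.filter (fun x => ω ∉ (openConn a₀ x : Set (BondConfig (Fin n)))) = C} else ∅ := by
  ext ω
  simp only [mem_inter_iff, mem_setOf_eq, Finset.mem_coe]
  split_ifs with hUC
  · simp only [mem_setOf_eq]
    constructor
    · exact fun h => h.2
    · intro hC
      refine ⟨fun x hx => ?_, hC⟩
      have hxC : x ∈ T.filter (fun x => ω ∉ (openConn a₀ x : Set (BondConfig (Fin n)))) := by
        rw [hC]; exact hUC hx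
      exact (Finset.mem_filter.1 hxC).2
  · simp only [mem_empty_iff_false, iff_false, not_and]
    intro hall hC
    apply hUC
    intro x hx
    rw [← hC]
    exact Finset.mem_filter.2 ⟨hU hx, hall x hx⟩

/-- **Avoidance probabilities are atom sums:** `μ(U cut) = Σ_{U ⊆ C ⊆ T} μ(cut set = C)` for `U ⊆ T`. [folklore] -/
theorem avoid_real_eq_sum (w : Sym2 (Fin n) → unitInterval) (a₀ : Fin n) (T U : Finset (Fin n)) (hU : U ⊆ T) :
    (prodBernoulli w).real {ω : BondConfig (Fin n) | ∀ x ∈ (U : Set (Fin n)), ω ∉ (openConn a₀ x : Set (BondConfig (Fin n)))} =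
      ∑ C ∈ T.powerset, if U ⊆ C then (prodBernoulli w).real
        {ω : BondConfig (Fin n) | T.filter (fun x => ω ∉ (openConn a₀ x : Set (BondConfig (Fin n)))) = C} else 0 := by
  rw [real_eq_sum_cutAtoms w a₀ T]
  refine Finset.sum_congr rfl fun C _ => ?_
  rw [avoid_inter_cutAtom a₀ T U C hU]
  split_ifs <;> simp

/-- **The threshold event is an atom sum:** `μ(h ≤ #cut T) = Σ_{C ⊆ T, |C| ≥ h} μ(cut set = C)`. [folklore] -/
theorem tail_real_eq_sum (w : Sym2 (Fin n) → unitInterval) (a₀ : Fin n) (T : Finset (Fin n)) (h : ℕ) :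
    (prodBernoulli w).real {ω : BondConfig (Fin n) | h ≤ (T.filter (fun x => ω ∉ (openConn a₀ x : Set (BondConfig (Fin n))))).card} =
      ∑ C ∈ T.powerset, if h ≤ C.card then (prodBernoulli w).real
        {ω : BondConfig (Fin n) | T.filter (fun x => ω ∉ (openConn a₀ x : Set (BondConfig (Fin n)))) = C} else 0 := by
  rw [real_eq_sum_cutAtoms w a₀ T]
  refine Finset.sum_congr rfl fun C _ => ?_
  have hset : {ω : BondConfig (Fin n) | h ≤ (T.filter (fun x => ω ∉ (openConn a₀ x : Set (BondConfig (Fin n))))).card} ∩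
      {ω | T.filter (fun x => ω ∉ (openConn a₀ x : Set (BondConfig (Fin n)))) = C} =
      if h ≤ C.card then {ω | T.filter (fun x => ω ∉ (openConn a₀ x : Set (BondConfig (Fin n)))) = C} else ∅ := by
    ext ω
    simp only [mem_inter_iff, mem_setOf_eq]
    split_ifs with hc
    · simp only [mem_setOf_eq]
      exact ⟨fun h' => h'.2, fun h' => ⟨by rw [h']; exact hc, h'⟩⟩
    · simp only [mem_empty_iff_false, iff_false, not_and]
      intro h1 h2; rw [h2] at h1; exact hc h1
  rw [hset]
  split_ifs <;> simp

/-- **`Σ_{|U| = j} μ(U cut) = Σ_C C(|C|, j)·μ(cut set = C)`** — the expected number of cut `j`-subsets of `T`. [folklore] -/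
theorem sum_avoid_powersetCard (w : Sym2 (Fin n) → unitInterval) (a₀ : Fin n) (T : Finset (Fin n)) (j : ℕ) :
    ∑ U ∈ T.powersetCard j, (prodBernoulli w).real
        {ω : BondConfig (Fin n) | ∀ x ∈ (U : Set (Fin n)), ω ∉ (openConn a₀ x : Set (BondConfig (Fin n)))} =
      ∑ C ∈ T.powerset, (C.card.choose j : ℝ) * (prodBernoulli w).real
        {ω : BondConfig (Fin n) | T.filter (fun x => ω ∉ (openConn a₀ x : Set (BondConfig (Fin n)))) = C} := by
  have h1 : ∀ U ∈ T.powersetCard j, (prodBernoulli w).real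
      {ω : BondConfig (Fin n) | ∀ x ∈ (U : Set (Fin n)), ω ∉ (openConn a₀ x : Set (BondConfig (Fin n)))} =
      ∑ C ∈ T.powerset, if U ⊆ C then (prodBernoulli w).real
        {ω : BondConfig (Fin n) | T.filter (fun x => ω ∉ (openConn a₀ x : Set (BondConfig (Fin n)))) = C} else 0 :=
    fun U hU => avoid_real_eq_sum w a₀ T U (Finset.mem_powersetCard.1 hU).1
  rw [Finset.sum_congr rfl h1, Finset.sum_comm]
  refine Finset.sum_congr rfl fun C hC => ?_
  rw [← Finset.sum_filter, Finset.sum_const, nsmul_eq_mul,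
    card_filter_subset_powersetCard T C (Finset.mem_powerset.1 hC) j]

/-! ### The law-level inequality -/

/-- **LAW-LEVEL FOUR-OF-SIX INEQUALITY** (any weight function; hub-first orientation).  For `|T| = 6`:
`μ(4 ≤ #cut T) ≤ (4/15)·Σ_{pairs U ⊆ T} μ(U cut) − (3/20)·Σ_{triples U ⊆ T} μ(U cut)` — the integral of the pointwise majorant
`1[k ≥ 4] ≤ (4/15)C(k,2) − (3/20)C(k,3)` (`coef_fourOfSix`) against the cut-set partition. [folklore] -/
theorem fourOfSix_lin (w : Sym2 (Fin n) → unitInterval) (a₀ : Fin n) (T : Finset (Fin n)) (hT : T.card = 6) :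
    (prodBernoulli w).real {ω : BondConfig (Fin n) | 4 ≤ (T.filter (fun x => ω ∉ (openConn a₀ x : Set (BondConfig (Fin n))))).card} ≤
      4 / 15 * ∑ U ∈ T.powersetCard 2, (prodBernoulli w).real
          {ω : BondConfig (Fin n) | ∀ x ∈ (U : Set (Fin n)), ω ∉ (openConn a₀ x : Set (BondConfig (Fin n)))} -
      3 / 20 * ∑ U ∈ T.powersetCard 3, (prodBernoulli w).real
          {ω : BondConfig (Fin n) | ∀ x ∈ (U : Set (Fin n)), ω ∉ (openConn a₀ x : Set (BondConfig (Fin n)))} := by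
  rw [tail_real_eq_sum w a₀ T 4, sum_avoid_powersetCard w a₀ T 2, sum_avoid_powersetCard w a₀ T 3, Finset.mul_sum,
    Finset.mul_sum, ← Finset.sum_sub_distrib]
  refine Finset.sum_le_sum fun C hC => ?_
  have hCcard : C.card ≤ 6 := hT ▸ Finset.card_le_card (Finset.mem_powerset.1 hC)
  have hcoef := coef_fourOfSix C.card hCcard
  have hm : 0 ≤ (prodBernoulli w).real
      {ω : BondConfig (Fin n) | T.filter (fun x => ω ∉ (openConn a₀ x : Set (BondConfig (Fin n)))) = C} := measureReal_nonneg
  have hmul := mul_le_mul_of_nonneg_right hcoef hm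
  split_ifs with h4
  · rw [if_pos h4] at hmul
    linarith
  · rw [if_neg h4] at hmul
    linarith

/-! ### van den Berg–Kahn per triple -/

/-- Two distinct pairs of a triple meet in a point and cover the triple. [folklore] -/
theorem pairs_of_triple {α : Type*} [DecidableEq α] (t p q : Finset α) (ht : t.card = 3)
    (hp : p ∈ t.powersetCard 2) (hq : q ∈ t.powersetCard 2) (hpq : p ≠ q) :
    t ⊆ p ∪ q ∧ (p ∩ q).Nonempty := by
  rw [Finset.mem_powersetCard] at hp hq
  have hu := Finset.card_union_add_card_inter p q
  rw [hp.2, hq.2] at hu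
  have hsub : p ∪ q ⊆ t := Finset.union_subset hp.1 hq.1
  have hle : (p ∪ q).card ≤ 3 := ht ▸ Finset.card_le_card hsub
  have hint : (p ∩ q).card ≤ 1 := by
    by_contra hgt
    push Not at hgt
    have h2 : p.card ≤ (p ∩ q).card := by rw [hp.2]; omega
    have hpq' : p ∩ q = p := Finset.eq_of_subset_of_card_le Finset.inter_subset_left h2
    have hpsub : p ⊆ q := by rw [← hpq']; exact Finset.inter_subset_right
    exact hpq (Finset.eq_of_subset_of_card_le hpsub (by rw [hp.2, hq.2]))
  refine ⟨?_, ?_⟩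
  · have h3 : t.card ≤ (p ∪ q).card := by rw [ht]; omega
    rw [Finset.eq_of_subset_of_card_le hsub h3]
  · rw [← Finset.card_pos]; omega

/-- **van den Berg–Kahn per triple.** For a triple `t ⊆ T` and `δ ≥ μ(x cut)` on `T`:
`(1/15)·Σ_{pairs p ⊂ t} μ(p cut) − (3/20)·μ(t cut) ≤ δ/15` — `three_pairs_le` with `μ(p cut)μ(q cut) ≤ μ((p ∩ q) cut)·μ(t cut) ≤ δ·μ(t cut)`
(`avoid_real_bk`) for the three pairs of pairs. [cite: VandenbergKahn2001, Thm 1.2 (p. 123)] -/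
theorem per_triple_avoid (w : Sym2 (Fin n) → unitInterval) (a₀ : Fin n) (T : Finset (Fin n)) (δ : ℝ)
    (hδ : ∀ x ∈ T, (prodBernoulli w).real (openConn a₀ x : Set (BondConfig (Fin n)))ᶜ ≤ δ)
    (t : Finset (Fin n)) (ht : t ∈ T.powersetCard 3) :
    1 / 15 * ∑ p ∈ t.powersetCard 2, (prodBernoulli w).real
        {ω : BondConfig (Fin n) | ∀ x ∈ (p : Set (Fin n)), ω ∉ (openConn a₀ x : Set (BondConfig (Fin n)))} -
      3 / 20 * (prodBernoulli w).real
        {ω : BondConfig (Fin n) | ∀ x ∈ (t : Set (Fin n)), ω ∉ (openConn a₀ x : Set (BondConfig (Fin n)))} ≤ δ / 15 := by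
  set av : Finset (Fin n) → ℝ := fun U => (prodBernoulli w).real
    {ω : BondConfig (Fin n) | ∀ x ∈ (U : Set (Fin n)), ω ∉ (openConn a₀ x : Set (BondConfig (Fin n)))} with hav
  have htT : t ⊆ T := (Finset.mem_powersetCard.1 ht).1
  have htc : t.card = 3 := (Finset.mem_powersetCard.1 ht).2
  have hP2card : (t.powersetCard 2).card = 3 := by rw [Finset.card_powersetCard, htc]; decide
  obtain ⟨p1, p2, p3, h12, h13, h23, hP2⟩ := Finset.card_eq_three.1 hP2card
  have hp1 : p1 ∈ t.powersetCard 2 := by rw [hP2]; simp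
  have hp2 : p2 ∈ t.powersetCard 2 := by rw [hP2]; simp
  have hp3 : p3 ∈ t.powersetCard 2 := by rw [hP2]; simp
  -- generic facts about avoidance probabilities of subsets of `t`
  have nn : ∀ U : Finset (Fin n), 0 ≤ av U := fun U => measureReal_nonneg
  have hsingle : ∀ x ∈ T, av {x} ≤ δ := by
    intro x hx
    have : av {x} = (prodBernoulli w).real (openConn a₀ x : Set (BondConfig (Fin n)))ᶜ := by
      simp only [hav, Finset.coe_singleton, avoid_single]
    rw [this]; exact hδ x hx
  have hle : ∀ p ∈ t.powersetCard 2, av p ≤ δ := by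
    intro p hp
    have hpt : p ⊆ t := (Finset.mem_powersetCard.1 hp).1
    obtain ⟨x, hx⟩ : p.Nonempty := by rw [← Finset.card_pos, (Finset.mem_powersetCard.1 hp).2]; norm_num
    have h1 : av p ≤ av {x} :=
      avoid_real_anti w a₀ (show (({x} : Finset (Fin n)) : Set (Fin n)) ⊆ (p : Set (Fin n)) by
        rw [Finset.coe_singleton, Set.singleton_subset_iff]; exact Finset.mem_coe.2 hx)
    exact h1.trans (hsingle x (htT (hpt hx)))
  have hprod : ∀ p ∈ t.powersetCard 2, ∀ q ∈ t.powersetCard 2, p ≠ q → av p * av q ≤ av t * δ := by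
    intro p hp q hq hpq
    obtain ⟨hsub, ⟨x, hx⟩⟩ := pairs_of_triple t p q htc hp hq hpq
    have hxp : x ∈ p := (Finset.mem_inter.1 hx).1
    have hxq : x ∈ q := (Finset.mem_inter.1 hx).2
    have hxT : x ∈ T := htT ((Finset.mem_powersetCard.1 hp).1 hxp)
    have h1 := avoid_real_bk w a₀ (p : Set (Fin n)) (q : Set (Fin n)) ({x} : Set (Fin n)) (t : Set (Fin n))
      (by
        intro y hy; rw [Set.mem_singleton_iff] at hy; subst hy
        exact ⟨Finset.mem_coe.2 hxp, Finset.mem_coe.2 hxq⟩)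
      (by
        intro y hy
        rcases Finset.mem_union.1 (hsub (Finset.mem_coe.1 hy)) with h | h
        · exact Or.inl (Finset.mem_coe.2 h)
        · exact Or.inr (Finset.mem_coe.2 h))
    rw [avoid_single] at h1
    calc av p * av q ≤ (prodBernoulli w).real (openConn a₀ x : Set (BondConfig (Fin n)))ᶜ * av t := h1
      _ ≤ δ * av t := mul_le_mul_of_nonneg_right (hδ x hxT) (nn t)
      _ = av t * δ := mul_comm _ _
  rw [hP2, Finset.sum_insert (by simp [h12, h13]), Finset.sum_insert (by simp [h23]), Finset.sum_singleton]
  have key := per_triple_le δ (av t) (av p1) (av p2) (av p3) (nn _) (nn _) (nn _) (hle _ hp1) (hle _ hp2) (hle _ hp3)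
    (nn _) (hprod _ hp1 _ hp2 h12) (hprod _ hp1 _ hp3 h13) (hprod _ hp2 _ hp3 h23)
  simp only [hav] at key
  linarith

/-- **`(4/15)·Σ_{pairs} μ(pair cut) − (3/20)·Σ_{triples} μ(triple cut) ≤ (4/3)·δ`** for `|T| = 6` and `δ ≥ μ(x cut)` on `T`: regroup the
pairs by triples (`sum_pairs_by_triples`) and apply `per_triple_avoid` to each of the `20` triples. [cite: VandenbergKahn2001, Thm 1.2 (p. 123)] -/
theorem fourOfSix_vdBK (w : Sym2 (Fin n) → unitInterval) (a₀ : Fin n) (T : Finset (Fin n)) (hT : T.card = 6) (δ : ℝ)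
    (hδ : ∀ x ∈ T, (prodBernoulli w).real (openConn a₀ x : Set (BondConfig (Fin n)))ᶜ ≤ δ) :
    4 / 15 * ∑ U ∈ T.powersetCard 2, (prodBernoulli w).real
          {ω : BondConfig (Fin n) | ∀ x ∈ (U : Set (Fin n)), ω ∉ (openConn a₀ x : Set (BondConfig (Fin n)))} -
      3 / 20 * ∑ U ∈ T.powersetCard 3, (prodBernoulli w).real
          {ω : BondConfig (Fin n) | ∀ x ∈ (U : Set (Fin n)), ω ∉ (openConn a₀ x : Set (BondConfig (Fin n)))} ≤ 4 / 3 * δ := by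
  have hre : 4 / 15 * ∑ U ∈ T.powersetCard 2, (prodBernoulli w).real
          {ω : BondConfig (Fin n) | ∀ x ∈ (U : Set (Fin n)), ω ∉ (openConn a₀ x : Set (BondConfig (Fin n)))} =
      1 / 15 * ∑ t ∈ T.powersetCard 3, ∑ p ∈ t.powersetCard 2, (prodBernoulli w).real
          {ω : BondConfig (Fin n) | ∀ x ∈ (p : Set (Fin n)), ω ∉ (openConn a₀ x : Set (BondConfig (Fin n)))} := by
    rw [sum_pairs_by_triples T hT]; ring
  rw [hre, Finset.mul_sum, Finset.mul_sum, ← Finset.sum_sub_distrib]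
  have hcard : (T.powersetCard 3).card = 20 := by rw [Finset.card_powersetCard, hT]; decide
  calc ∑ t ∈ T.powersetCard 3, (1 / 15 * ∑ p ∈ t.powersetCard 2, (prodBernoulli w).real
            {ω : BondConfig (Fin n) | ∀ x ∈ (p : Set (Fin n)), ω ∉ (openConn a₀ x : Set (BondConfig (Fin n)))} -
          3 / 20 * (prodBernoulli w).real
            {ω : BondConfig (Fin n) | ∀ x ∈ (t : Set (Fin n)), ω ∉ (openConn a₀ x : Set (BondConfig (Fin n)))})
      ≤ ∑ t ∈ T.powersetCard 3, δ / 15 := Finset.sum_le_sum fun t ht => per_triple_avoid w a₀ T δ hδ t ht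
    _ = 4 / 3 * δ := by rw [Finset.sum_const, hcard, nsmul_eq_mul]; ring

/-! ### The counting form -/

/-- **AT LEAST FOUR OF SIX RELAYS CUT: `μ ≤ (4/3)·δ`**, counting form over a 6-element finset (hub-second orientation `v ↮ a₀`, as in
`threeOfFour_count` / `fourOfFive_count`), for every weight function and every `δ` bounding the six cut probabilities — the van den
Berg–Kahn constant of the root cell `R_4 = (6,4)` (sup of the abstract hub-rooted programme; Markov: `3/2`). [cite: VandenbergKahn2001, Thm 1.2 (p. 123)] -/
theorem fourOfSix_count (w : Sym2 (Fin n) → unitInterval) (a₀ : Fin n) (T : Finset (Fin n)) (hT : T.card = 6) (δ : ℝ)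
    (hδ : ∀ v ∈ T, (prodBernoulli w).real (openConn v a₀ : Set (BondConfig (Fin n)))ᶜ ≤ δ) :
    (prodBernoulli w).real {ω : BondConfig (Fin n) | 4 ≤ (T.filter fun v => ω ∉ openConn v a₀).card} ≤ 4 / 3 * δ := by
  have hδ' : ∀ x ∈ T, (prodBernoulli w).real (openConn a₀ x : Set (BondConfig (Fin n)))ᶜ ≤ δ := by
    intro x hx; rw [knThm2_openConn_comm]; exact hδ x hx
  have hset : {ω : BondConfig (Fin n) | 4 ≤ (T.filter fun v => ω ∉ openConn v a₀).card} =
      {ω : BondConfig (Fin n) | 4 ≤ (T.filter (fun x => ω ∉ (openConn a₀ x : Set (BondConfig (Fin n))))).card} := by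
    ext ω
    simp only [mem_setOf_eq]
    rw [Finset.filter_congr (fun v _ => by rw [knThm2_openConn_comm v a₀])]
  rw [hset]
  exact (fourOfSix_lin w a₀ T hT).trans (fourOfSix_vdBK w a₀ T hT δ hδ')

end HubOnly

end Summit.CriticalPhenomena.PercolationContinuityZ3.Theorems

end
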